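import Mathlib
import Summits.Ventures.HodgeRepro.Tier4.Line4.ChainInputsWitness

/-!
# Tier4/Line4/ChainInputsBind — C-L4-CHAIN-BIND: the `hchain` binder of the (7b) assembly (TailSeesawFull) proved by
name from `chainInputs_witness_of_pieces`, with display (8), ARCH and FIN quantified over the admissible `(finf, e)`

Blind re-derivation cell `pub-hodge-repro`, Tier 4 «prove the step» (README §9–§10), seat t4-L2-p3 (gen 5; plan-4 g7's
cut S16082).  Tree path `lean/Summits/Ventures/HodgeRepro/Tier4/Line4/ChainInputsBind.lean`.  Imports this seat's
ChainInputsWitness (`chainInputs_witness_of_pieces`).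

**`hchain_of_witness`**: the binder `hchain` of `tailForArch_seesaw_of_pieces_full` (TailSeesawFull L86–L99) —
`∀ finf, IsArchCoeffD … finf → ∀ e, IsInfFactor e → (equivariance) → archFactor (finf ∗ e) ≠ 0 → ∀ M, ChainInputs … (S.conv
(prodFn finf (ffinMu μ₀ γ₀ (p^M))) (testNat e (p^M))) (c₀ · (finf ∗ e)) (levelDC γ₀ (p^M))` — as a THEOREM from display (8)
`PoincareOfDecay`, the ARCH clauses quantified over `(finf, e)` under `IsArchCoeffD finf` and `IsInfFactor e`
(`hFinfc hdec hbound hA hIinf`, L4-x2's ConvInfRegularity + IntegArch), the FIN clauses quantified over the level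
(`hB hIfin hint`, L1-p1's ChainInputsFin) and (B1) quantified over `(finf, e)` and the level (`hB1`).  The residual of this
layer = exactly these named hypotheses; nothing else.  `n₁ := 0`, `N := M` in the witness theorem (`ffinMuNat_lev` at
`lev n := p ^ (n + 0)`).

No printed input is consumed.  HC_CM is NOT proved by anyone in this repository.
-/

set_option autoImplicit false
noncomputable section
namespace Summit.Ventures.HodgeRepro.Tier4.Line4
open Summit.Ventures.HodgeRepro.Tier4 Summit.Ventures.HodgeRepro.Tier4.Common
  Summit.Ventures.HodgeRepro.Tier4.Line1 Summit.Ventures.HodgeRepro.Tier4.Line4.L1Class MeasureTheory NumberField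
open scoped ComplexConjugate Topology Pointwise NNReal

section Bind
variable {k : Type} [Field k] [NumberField k] (W : PlaneData k) [MeasurableSpace (GA W)] [BorelSpace (GA W)]
  (R : RTFData W)

/-- **THE `hchain` BINDER OF THE (7b) ASSEMBLY, BY NAME** (C-L4-CHAIN-BIND): from display (8) and the ARCH / FIN / (B1)
clauses quantified over the admissible `(finf, e)` and the level, `ChainInputs` holds at every level `p^M` for every
admissible pair — `chainInputs_witness_of_pieces` at `n₁ := 0`, `N := M`. -/
theorem hchain_of_witness (μ : Measure (GA W)) [μ.IsHaarMeasure] (DG : Set (GA W))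
    (fdG : IsFundamentalDomain (rationalPoints W) DG μ) (compG : IsCompact (closure DG))
    [R.μT.IsHaarMeasure] [R.μT'.IsHaarMeasure] (compT : IsCompact (closure R.DT)) (compT' : IsCompact (closure R.DT'))
    (hR : R.IsHaar) (hc : Continuous R.chi) (hu : ∀ a, ‖R.chi a‖ = 1) (hc' : Continuous R.chi')
    (hu' : ∀ a, ‖R.chi' a‖ = 1) [CompactSpace (torusInf' W)]
    (q : QuadData k) (g g' : Matrix (Fin 4) (Fin 4) k) (w₀ : InfinitePlace k) (eP eM eP' eM' : InfinitePlace k → ℤ)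
    (γ₀ : rationalPoints W)
    (νinf : Measure (torusInf W)) (νf : Measure (torusFin W)) (νinf' : Measure (torusInf' W))
    (νf' : Measure (torusFin' W)) (DZf : Set (torusFin W))
    (μinf : Measure (infinitePart W)) [μinf.IsHaarMeasure] (μ₀ : Measure (finitePart W)) [μ₀.IsHaarMeasure]
    (c₀ : ℝ≥0) (hcμ₀ : μ = c₀ • Measure.map (gaSplit W).symm (μinf.prod μ₀)) (p : ℕ) (hp : p ≠ 0)
    -- display (8)
    (h8 : L1Class.PoincareOfDecay W (Setting.ofAdelicData W R μ DG fdG compG compT compT'))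
    -- ARCH, quantified over the admissible `(finf, e)`
    (hFinfc : ∀ finf : GA W → ℂ,
      IsArchCoeffD W (Setting.ofAdelicData W R μ DG fdG compG compT compT') R q g g' w₀ eP eM eP' eM' (γ₀ : GA W)
        νinf νinf' finf → ∀ e : GA W → ℂ, IsInfFactor W e →
      Continuous fun x => (c₀ : ℂ) * convInf W μinf finf e x)
    (hdec : ∀ finf : GA W → ℂ,
      IsArchCoeffD W (Setting.ofAdelicData W R μ DG fdG compG compT compT') R q g g' w₀ eP eM eP' eM' (γ₀ : GA W)
        νinf νinf' finf → ∀ e : GA W → ℂ, IsInfFactor W e →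
      L1Class.HasDecay3 W fun x => (c₀ : ℂ) * convInf W μinf finf e x)
    (hbound : ∀ finf : GA W → ℂ,
      IsArchCoeffD W (Setting.ofAdelicData W R μ DG fdG compG compT compT') R q g g' w₀ eP eM eP' eM' (γ₀ : GA W)
        νinf νinf' finf → ∀ e : GA W → ℂ, IsInfFactor W e →
      ∃ C : ℝ, ∀ x, ‖(c₀ : ℂ) * convInf W μinf finf e x‖ ≤ C)
    (hA : ∀ finf : GA W → ℂ,
      IsArchCoeffD W (Setting.ofAdelicData W R μ DG fdG compG compT compT') R q g g' w₀ eP eM eP' eM' (γ₀ : GA W)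
        νinf νinf' finf → ∀ e : GA W → ℂ, IsInfFactor W e →
      ∀ t : torusT W, Integrable (fun a : torusInf' W => conj (R.chi' (a : torusT' W)) *
        ((c₀ : ℂ) * convInf W μinf finf e
          ((GA.ofInfPart W t)⁻¹ * GA.ofInfPart W (γ₀ : GA W) * ((a : torusT' W) : GA W)))) νinf')
    (hIinf : ∀ finf : GA W → ℂ,
      IsArchCoeffD W (Setting.ofAdelicData W R μ DG fdG compG compT compT') R q g g' w₀ eP eM eP' eM' (γ₀ : GA W)
        νinf νinf' finf → ∀ e : GA W → ℂ, IsInfFactor W e →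
      Integrable (fun a : torusInf W => R.chi a *
        innerInf W R (fun x => (c₀ : ℂ) * convInf W μinf finf e x) (γ₀ : GA W) νinf' a) νinf)
    -- FIN, quantified over the level
    (hB : ∀ M : ℕ, ∀ t : torusT W, Integrable (fun b : torusFin' W => conj (R.chi' (b : torusT' W)) *
      levelDC W (γ₀ : GA W) (p ^ M) ((GA.ofFinPart W t)⁻¹ * GA.ofFinPart W (γ₀ : GA W) * ((b : torusT' W) : GA W)))
      νf')
    (hIfin : ∀ M : ℕ, IntegrableOn (fun b : torusFin W => R.chi b *
      innerFin W R (levelDC W (γ₀ : GA W) (p ^ M)) (γ₀ : GA W) νf' b) DZf νf)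
    (hint : ∀ M : ℕ, IntegrableOn (fun x : torusFin W × torusFin' W => R.chi x.1 * conj (R.chi' x.2) *
      levelDC W (γ₀ : GA W) (p ^ M)
        ((((x.1 : torusT W) : GA W))⁻¹ * GA.ofFinPart W (γ₀ : GA W) * ((x.2 : torusT' W) : GA W)))
      (DZf ×ˢ Set.univ) (νf.prod νf'))
    -- (B1), quantified over the admissible `(finf, e)` and the level
    (hB1 : ∀ finf : GA W → ℂ,
      IsArchCoeffD W (Setting.ofAdelicData W R μ DG fdG compG compT compT') R q g g' w₀ eP eM eP' eM' (γ₀ : GA W)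
        νinf νinf' finf → ∀ e : GA W → ℂ, IsInfFactor W e →
      (∀ (w : InfinitePlace k) (κ : GA W), κ ∈ localTorusAt' W w → ∀ x,
        e (x * κ) = weightAt' W q w g g' 0 κ ^ (-eP' w) * weightAt' W q w g g' 1 κ ^ (-eM' w) * e x) →
      L1Class.archFactor W R (convInf W μinf finf e) (γ₀ : GA W) νinf νinf' ≠ 0 →
      ∀ M : ℕ, IntegrableOn (fun t : torusT W => R.chi t * innerFull W R
        ((Setting.ofAdelicData W R μ DG fdG compG compT compT').conv
          (L1Class.prodFn W finf (ffinMu W μ₀ (γ₀ : GA W) (p ^ M))) (testNat W e (p ^ M))) (γ₀ : GA W) t)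
        (prodDomain W DZf) R.μT) :
    ∀ finf : GA W → ℂ,
      IsArchCoeffD W (Setting.ofAdelicData W R μ DG fdG compG compT compT') R q g g' w₀ eP eM eP' eM' (γ₀ : GA W)
        νinf νinf' finf →
      ∀ e : GA W → ℂ, IsInfFactor W e →
        (∀ (w : InfinitePlace k) (κ : GA W), κ ∈ localTorusAt' W w → ∀ x,
          e (x * κ) = weightAt' W q w g g' 0 κ ^ (-eP' w) * weightAt' W q w g g' 1 κ ^ (-eM' w) * e x) →
        L1Class.archFactor W R (convInf W μinf finf e) (γ₀ : GA W) νinf νinf' ≠ 0 →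
        ∀ M : ℕ, ChainInputs W R γ₀ νinf νf νinf' νf' DZf
          ((Setting.ofAdelicData W R μ DG fdG compG compT compT').conv
            (L1Class.prodFn W finf (ffinMu W μ₀ (γ₀ : GA W) (p ^ M))) (testNat W e (p ^ M)))
          (fun x => (c₀ : ℂ) * convInf W μinf finf e x) (levelDC W (γ₀ : GA W) (p ^ M)) := by
  intro finf hfinf e he hequiv harch M
  have hN : p ^ (M + 0) ≠ 0 := pow_ne_zero _ hp
  have hlev : ffinMuNat W μ₀ (γ₀ : GA W) (fun n => p ^ (n + 0)) (p ^ (M + 0)) = ffinMu W μ₀ (γ₀ : GA W) (p ^ (M + 0)) :=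
    ffinMuNat_lev W μ₀ (γ₀ : GA W) (lev := fun n => p ^ (n + 0)) (n := M) hN
  obtain ⟨C, hC⟩ := hbound finf hfinf e he
  have hB1' : IntegrableOn (fun t : torusT W => R.chi t * innerFull W R
      ((Setting.ofAdelicData W R μ DG fdG compG compT compT').conv
        (L1Class.prodFn W finf (ffinMuNat W μ₀ (γ₀ : GA W) (fun n => p ^ (n + 0)) (p ^ (M + 0))))
        (testNat W e (p ^ (M + 0)))) (γ₀ : GA W) t) (prodDomain W DZf) R.μT := by
    rw [hlev]
    exact hB1 finf hfinf e he hequiv harch M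
  have h := chainInputs_witness_of_pieces W R μ DG fdG compG compT compT' hR hc hu hc' hu' γ₀ νinf νf νinf' νf' DZf
    μinf μ₀ c₀ hcμ₀ finf e p 0 M hp h8 (hFinfc finf hfinf e he) (hdec finf hfinf e he) C hC hB1'
    (hA finf hfinf e he) (hB M) (hIinf finf hfinf e he) (hIfin M) (hint M)
  rw [hlev] at h
  exact h

end Bind

end Summit.Ventures.HodgeRepro.Tier4.Line4
end
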